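import Literature.Analysis.FluidPDE.SereginZajaczkowski2007SwirlEquationProofs
import HarnessLib

/-!
# Seregin 2020, (2.2): the swirl equation off the axis, on a general rotation-invariant region

Analysis/FluidPDE proofs file (theorems only; no definitions, no named facts), on the discharge
path of the named fact `Literature.Analysis.FluidPDE.Seregin2020_axisymmetricSingularPoint_typeII`
(G. Seregin, *Local regularity of axisymmetric solutions to the Navier–Stokes equations*, Anal.
Math. Phys. 10 (2020), Paper No. 46 = arXiv:2006.04140, Thm. 2.1). The first step of the printed
proof of Thm. 2.1 (p. 4 of the arXiv version) is the equation for the swirl `σ = ϱ v_φ = v₂x₁ - v₁x₂`: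

> "It is easy to check that `σ` satisfies the equation
> `∂ₜσ + (v + 2 (x', 0)/|x'|²)·∇σ - Δσ = 0` (2.2)
> in `Q ∖ ({x' = 0} × ]-1, 0[)`",

used for a suitable weak axisymmetric solution which is smooth off the axis ("any spatial
derivative of `v` is Hölder continuous in `𝒞 × ]-1,0] ∖ S`", `S ⊂ {x' = 0}`).

The tree proves (2.2) — in the equivalent form `∂ₜα + V·∇α - Δα + (2/ϱ)∂_ϱα = 0`,
`α = x₀V₁ - x₁V₀ = swirl (V t)`, integrated in time at each point — for the hypothesis class
`SereginZajaczkowski2007.IsSmoothAxisymmetricSolutionOn` on ONE fixed shell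
`𝒞(1/4, 3; 2) × ]-2², 0[` (`SereginZajaczkowski2007.SwirlEquation_holds`). Its proof is local and
uses of the shell only that it is open, rotation invariant, off the axis and a product
`]lo, hi[ × U`; this file records the same statement for ANY such region `S` (this is the form
needed on the off-axis part `]-1, 0[ × (B(0,1) ∖ {x' = 0})` of the unit cylinder in the Moser
iteration (2.3)–(2.6) of Seregin's proof):

* `Seregin2020.sum_transfer_eq_swirlOperator_offAxis`, `Seregin2020.continuousOn_swirlOperator_offAxis`,
  `Seregin2020.integral_swirl_mul_timeDeriv_add_eq_zero_offAxis` — the pointwise identity, the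
  continuity of `Δα - Dα[V] - (2/ϱ)∂_ϱα` on `S`, and (2.2) in `𝒟'(S)` (verbatim the tree's proofs
  for the shell, `SereginZajaczkowski2007SwirlWeak.lean` / `…SwirlEquationProofs.lean`, with the
  shell replaced by `S`);
* `Seregin2020.swirl_sub_eq_intervalIntegral_offAxis` — (2.2) integrated in time at every point
  of `S = ]lo, hi[ × U`: `α(t, x) - α(s, x) = ∫ₛᵗ (Δα - Dα[V] - (2/ϱ)∂_ϱα)(r, x) dr`;
* `Seregin2020.hasDerivAt_swirl_offAxis` — hence `t ↦ α(t, x)` is differentiable on `]lo, hi[`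
  with the classical derivative `Δα - Dα[V] - (2/ϱ)∂_ϱα`, continuous in `(t, x)` on `S`.

## References

* G. Seregin, Anal. Math. Phys. 10 (2020) no. 4, Paper 46 = arXiv:2006.04140, proof of Thm. 2.1,
  (2.2) (arXiv p. 4). [`Seregin2020`]
* G. Seregin, W. Zajaczkowski, SIAM J. Math. Anal. 39 (2007) 669–685, proof of Lemma 4.3, (4.15)
  (the same equation, `α = ϱV_φ`). [`SereginZajaczkowski2007`]
* G. Koch, N. Nadirashvili, G. Seregin, V. Šverák, Acta Math. 203 (2009) 83–105, (1.8).
  [`KochNadirashviliSereginSverak2009`]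
-/

noncomputable section

open MeasureTheory Set Function Filter Topology TopologicalSpace Metric WithLp
open scoped NNReal ENNReal ContDiff InnerProductSpace RealInnerProductSpace Laplacian

namespace Literature.Analysis.FluidPDE

namespace Seregin2020

open SereginZajaczkowski2007 SereginSverak2009

variable {V : ℝ → (EuclideanSpace ℝ (Fin 3)) → (EuclideanSpace ℝ (Fin 3))} {P : ℝ → (EuclideanSpace ℝ (Fin 3)) → ℝ} {S : Opens (ℝ × (EuclideanSpace ℝ (Fin 3)))} {φ : ℝ → (EuclideanSpace ℝ (Fin 3)) → ℝ}

/-! ### The pointwise identity off the axis -/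

/-- **The transferred derivatives give the swirl operator**, at every point of `S` off the axis:
with `eⱼ` the standard frame, `Σⱼ (-∂ⱼ(αVⱼ) + 2⟪J ∂ⱼV, eⱼ⟫ + ∂ⱼ∂ⱼα) = Δα - Dα[V] - (2/ϱ)∂_ϱα`
(`div V = 0`, `Δα = ⟪Jx, ΔV⟫ + 2(∂₀V₁ - ∂₁V₀)`, `∂_ϱα = ϱ(∂₀V₁ - ∂₁V₀)` by axial symmetry, and
`ϱ ≠ 0`). The tree's `sum_transfer_eq_swirlOperator` for a general region. [folklore] -/
theorem sum_transfer_eq_swirlOperator_offAxis (hV : IsSmoothAxisymmetricSolutionOn S V P)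
    {z : ℝ × (EuclideanSpace ℝ (Fin 3))} (hz : z ∈ (S : Set (ℝ × (EuclideanSpace ℝ (Fin 3))))) (hρ : cylRadius z.2 ≠ 0) :
    ∑ j, (-fderiv ℝ (fun y => swirl (V z.1) y * ⟪V z.1 y, (EuclideanSpace.basisFun (Fin 3) ℝ) j⟫) z.2
          ((EuclideanSpace.basisFun (Fin 3) ℝ) j) +
        2 * ⟪rotGen (fderiv ℝ (V z.1) z.2 ((EuclideanSpace.basisFun (Fin 3) ℝ) j)),
          (EuclideanSpace.basisFun (Fin 3) ℝ) j⟫ +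
        fderiv ℝ (fun y => fderiv ℝ (swirl (V z.1)) y ((EuclideanSpace.basisFun (Fin 3) ℝ) j)) z.2
          ((EuclideanSpace.basisFun (Fin 3) ℝ) j)) =
      (Δ (swirl (V z.1))) z.2 - fderiv ℝ (swirl (V z.1)) z.2 (V z.1 z.2) -
        2 / cylRadius z.2 * partialDeriv (eR z.2) (swirl (V z.1)) z.2 := by
  have hsm := hV.contDiffAt z hz
  have hd := hV.differentiableAt hz
  have hW3 : ∀ j, fderiv ℝ (fun y => fderiv ℝ (swirl (V z.1)) y ((EuclideanSpace.basisFun (Fin 3) ℝ) j)) z.2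
      ((EuclideanSpace.basisFun (Fin 3) ℝ) j) =
      ⟪rotGen z.2, iteratedFDeriv ℝ 2 (V z.1) z.2
        ![(EuclideanSpace.basisFun (Fin 3) ℝ) j, (EuclideanSpace.basisFun (Fin 3) ℝ) j]⟫ +
        2 * ⟪rotGen ((EuclideanSpace.basisFun (Fin 3) ℝ) j),
          fderiv ℝ (V z.1) z.2 ((EuclideanSpace.basisFun (Fin 3) ℝ) j)⟫ :=
    fun j => fderiv_fderiv_swirl_apply_of_contDiffAt hsm ((EuclideanSpace.basisFun (Fin 3) ℝ) j)
  have hW2 : ∀ j, ⟪rotGen (fderiv ℝ (V z.1) z.2 ((EuclideanSpace.basisFun (Fin 3) ℝ) j)),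
      (EuclideanSpace.basisFun (Fin 3) ℝ) j⟫ =
      -⟪rotGen ((EuclideanSpace.basisFun (Fin 3) ℝ) j),
        fderiv ℝ (V z.1) z.2 ((EuclideanSpace.basisFun (Fin 3) ℝ) j)⟫ :=
    fun j => inner_rotGen_comm_neg _ _
  have hsum : ∑ j, (-fderiv ℝ (fun y => swirl (V z.1) y * ⟪V z.1 y, (EuclideanSpace.basisFun (Fin 3) ℝ) j⟫) z.2
          ((EuclideanSpace.basisFun (Fin 3) ℝ) j) +
        2 * ⟪rotGen (fderiv ℝ (V z.1) z.2 ((EuclideanSpace.basisFun (Fin 3) ℝ) j)),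
          (EuclideanSpace.basisFun (Fin 3) ℝ) j⟫ +
        fderiv ℝ (fun y => fderiv ℝ (swirl (V z.1)) y ((EuclideanSpace.basisFun (Fin 3) ℝ) j)) z.2
          ((EuclideanSpace.basisFun (Fin 3) ℝ) j)) =
      ⟪rotGen z.2, (Δ (V z.1)) z.2⟫ - fderiv ℝ (swirl (V z.1)) z.2 (V z.1 z.2) := by
    have hterm : ∀ j, -fderiv ℝ (fun y => swirl (V z.1) y * ⟪V z.1 y, (EuclideanSpace.basisFun (Fin 3) ℝ) j⟫) z.2
          ((EuclideanSpace.basisFun (Fin 3) ℝ) j) +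
        2 * ⟪rotGen (fderiv ℝ (V z.1) z.2 ((EuclideanSpace.basisFun (Fin 3) ℝ) j)),
          (EuclideanSpace.basisFun (Fin 3) ℝ) j⟫ +
        fderiv ℝ (fun y => fderiv ℝ (swirl (V z.1)) y ((EuclideanSpace.basisFun (Fin 3) ℝ) j)) z.2
          ((EuclideanSpace.basisFun (Fin 3) ℝ) j) =
        ⟪rotGen z.2, iteratedFDeriv ℝ 2 (V z.1) z.2
          ![(EuclideanSpace.basisFun (Fin 3) ℝ) j, (EuclideanSpace.basisFun (Fin 3) ℝ) j]⟫ -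
          fderiv ℝ (fun y => swirl (V z.1) y * ⟪V z.1 y, (EuclideanSpace.basisFun (Fin 3) ℝ) j⟫) z.2
            ((EuclideanSpace.basisFun (Fin 3) ℝ) j) := by
      intro j
      rw [hW3, hW2]
      ring
    simp only [hterm, Finset.sum_sub_distrib, sum_inner_rotGen_iteratedFDeriv,
      sum_fderiv_swirl_mul_inner hV hz]
  rw [hsum]
  -- the swirl operator at `z`
  have hax : ∀ θ : ℝ, ∀ y ∈ {y : (EuclideanSpace ℝ (Fin 3)) | (z.1, y) ∈ (S : Set (ℝ × (EuclideanSpace ℝ (Fin 3))))},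
      V z.1 (rotZ θ y) = rotZ θ (V z.1 y) := fun θ y hy => hV.axisymmetric θ (z.1, y) hy
  have hx : z.2 ∈ {y : (EuclideanSpace ℝ (Fin 3)) | (z.1, y) ∈ (S : Set (ℝ × (EuclideanSpace ℝ (Fin 3))))} := hz
  rw [laplacian_swirl_of_contDiffAt hsm, partialDeriv_eR_swirl_of_mem hax hx hd]
  field_simp
  ring

/-! ### The swirl operator is continuous on `S` -/

/-- The radial unit vector `e_ϱ` is continuous off the axis. [folklore] -/
theorem continuousOn_eR_offAxis : ContinuousOn eR {x : (EuclideanSpace ℝ (Fin 3)) | cylRadius x ≠ 0} := by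
  have hh : Continuous fun x : (EuclideanSpace ℝ (Fin 3)) => (toLp 2 ![x 0, x 1, 0] : (EuclideanSpace ℝ (Fin 3))) := by
    refine (PiLp.continuous_toLp 2 _).comp (continuous_pi fun i => ?_)
    have h0 : Continuous fun x : (EuclideanSpace ℝ (Fin 3)) => x 0 := PiLp.continuous_apply 2 _ 0
    have h1 : Continuous fun x : (EuclideanSpace ℝ (Fin 3)) => x 1 := PiLp.continuous_apply 2 _ 1
    fin_cases i
    · exact h0.congr fun x => by simp
    · exact h1.congr fun x => by simp
    · exact (continuous_const (y := (0 : ℝ))).congr fun x => by simp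
  exact (continuous_cylRadius.continuousOn.inv₀ fun x hx => hx).smul hh.continuousOn

/-- **The right-hand side `Δα - Dα[V] - (2/ϱ)∂_ϱα` of (2.2) is continuous on `S`** whenever `S`
does not meet the axis (all spatial derivatives of `V` are continuous on `S` in space–time for
the class). The tree's `continuousOn_swirlOperator` for a general region.
[cite: Seregin2020, proof of Thm. 2.1, (2.2) (arXiv p. 4)] -/
theorem continuousOn_swirlOperator_offAxis (hV : IsSmoothAxisymmetricSolutionOn S V P)
    (hρ : ∀ z ∈ (S : Set (ℝ × (EuclideanSpace ℝ (Fin 3)))), cylRadius z.2 ≠ 0) :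
    ContinuousOn (fun z : ℝ × (EuclideanSpace ℝ (Fin 3)) => (Δ (swirl (V z.1))) z.2 - fderiv ℝ (swirl (V z.1)) z.2 (V z.1 z.2) -
      2 / cylRadius z.2 * partialDeriv (eR z.2) (swirl (V z.1)) z.2) (S : Set (ℝ × (EuclideanSpace ℝ (Fin 3)))) := by
  have hJ : Continuous fun z : ℝ × (EuclideanSpace ℝ (Fin 3)) => rotGen z.2 := rotGenL.continuous.comp continuous_snd
  -- (i) the Laplacian of the swirl
  have hL : ContinuousOn (fun z : ℝ × (EuclideanSpace ℝ (Fin 3)) => (Δ (swirl (V z.1))) z.2) (S : Set (ℝ × (EuclideanSpace ℝ (Fin 3)))) := by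
    have hΔV : ContinuousOn (fun z : ℝ × (EuclideanSpace ℝ (Fin 3)) => (Δ (V z.1)) z.2) (S : Set (ℝ × (EuclideanSpace ℝ (Fin 3)))) := by
      have e : (fun z : ℝ × (EuclideanSpace ℝ (Fin 3)) => (Δ (V z.1)) z.2) = fun z => ∑ j, iteratedFDeriv ℝ 2 (V z.1) z.2
          ![EuclideanSpace.basisFun (Fin 3) ℝ j, EuclideanSpace.basisFun (Fin 3) ℝ j] := by
        funext z
        exact congrFun (InnerProductSpace.laplacian_eq_iteratedFDeriv_orthonormalBasis (V z.1)
          (EuclideanSpace.basisFun (Fin 3) ℝ)) z.2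
      rw [e]
      exact continuousOn_finsetSum _ fun j _ =>
        (continuous_eval_const _).comp_continuousOn (hV.continuousOn_iteratedFDeriv 2)
    have hω : ContinuousOn (fun z : ℝ × (EuclideanSpace ℝ (Fin 3)) => fderiv ℝ (V z.1) z.2 (EuclideanSpace.single 0 1) 1 -
        fderiv ℝ (V z.1) z.2 (EuclideanSpace.single 1 1) 0) (S : Set (ℝ × (EuclideanSpace ℝ (Fin 3)))) :=
      ((EuclideanSpace.proj (1 : Fin 3)).continuous.comp_continuousOn
        (hV.continuousOn_fderiv.clm_apply continuousOn_const)).sub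
        ((EuclideanSpace.proj (0 : Fin 3)).continuous.comp_continuousOn
          (hV.continuousOn_fderiv.clm_apply continuousOn_const))
    have hc : ContinuousOn (fun z : ℝ × (EuclideanSpace ℝ (Fin 3)) => ⟪rotGen z.2, (Δ (V z.1)) z.2⟫ +
        2 * (fderiv ℝ (V z.1) z.2 (EuclideanSpace.single 0 1) 1 -
          fderiv ℝ (V z.1) z.2 (EuclideanSpace.single 1 1) 0)) (S : Set (ℝ × (EuclideanSpace ℝ (Fin 3)))) :=
      (hJ.continuousOn.inner hΔV).add (continuousOn_const.mul hω)
    exact hc.congr fun z hz => laplacian_swirl_of_contDiffAt (hV.contDiffAt z hz)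
  -- (ii) the convective derivative of the swirl
  have hC : ContinuousOn (fun z : ℝ × (EuclideanSpace ℝ (Fin 3)) => fderiv ℝ (swirl (V z.1)) z.2 (V z.1 z.2)) (S : Set (ℝ × (EuclideanSpace ℝ (Fin 3)))) := by
    have hc : ContinuousOn (fun z : ℝ × (EuclideanSpace ℝ (Fin 3)) => ⟪rotGen z.2, fderiv ℝ (V z.1) z.2 (V z.1 z.2)⟫ +
        ⟪rotGen (V z.1 z.2), V z.1 z.2⟫) (S : Set (ℝ × (EuclideanSpace ℝ (Fin 3)))) :=
      (hJ.continuousOn.inner (hV.continuousOn_fderiv.clm_apply hV.continuousOn_velocity)).add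
        ((rotGenL.continuous.comp_continuousOn hV.continuousOn_velocity).inner hV.continuousOn_velocity)
    exact hc.congr fun z hz => fderiv_swirl_apply (hV.differentiableAt hz) _
  -- (iii) the radial derivative of the swirl
  have hR : ContinuousOn (fun z : ℝ × (EuclideanSpace ℝ (Fin 3)) => 2 / cylRadius z.2 * partialDeriv (eR z.2) (swirl (V z.1)) z.2)
      (S : Set (ℝ × (EuclideanSpace ℝ (Fin 3)))) := by
    have heR : ContinuousOn (fun z : ℝ × (EuclideanSpace ℝ (Fin 3)) => eR z.2) (S : Set (ℝ × (EuclideanSpace ℝ (Fin 3)))) :=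
      continuousOn_eR_offAxis.comp continuous_snd.continuousOn fun z hz => hρ z hz
    have h2 : ContinuousOn (fun z : ℝ × (EuclideanSpace ℝ (Fin 3)) => 2 / cylRadius z.2) (S : Set (ℝ × (EuclideanSpace ℝ (Fin 3)))) :=
      continuousOn_const.div (continuous_cylRadius.comp continuous_snd).continuousOn hρ
    have hc : ContinuousOn (fun z : ℝ × (EuclideanSpace ℝ (Fin 3)) => 2 / cylRadius z.2 *
        (⟪rotGen z.2, fderiv ℝ (V z.1) z.2 (eR z.2)⟫ + ⟪rotGen (eR z.2), V z.1 z.2⟫)) (S : Set (ℝ × (EuclideanSpace ℝ (Fin 3)))) :=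
      h2.mul ((hJ.continuousOn.inner (hV.continuousOn_fderiv.clm_apply heR)).add
        ((rotGenL.continuous.comp_continuousOn heR).inner hV.continuousOn_velocity))
    refine hc.congr fun z hz => ?_
    simp only [partialDeriv_apply, fderiv_swirl_apply (hV.differentiableAt hz)]
  exact (hL.sub hC).sub hR

/-! ### The weak swirl equation on `S` -/

/-- **Seregin 2020, (2.2) in the sense of distributions on a rotation-invariant off-axis region.**
Let `S ⊆ ℝ × (EuclideanSpace ℝ (Fin 3))` be open, invariant under the rotations `(t, x) ↦ (t, R_θ x)` about the axis and
disjoint from the axis, and let `(V, P)` be in the class `IsSmoothAxisymmetricSolutionOn S V P`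
(suitable weak solution on `S`, axially symmetric and `C^∞` in `x` at the points of `S`, all
spatial derivatives continuous in space–time). Then the swirl `α = x₀V₁ - x₁V₀ = ϱV_φ` satisfies,
for every scalar test function `φ ∈ C_c^∞(S)`,
`∫∫ (α ∂ₜφ + (Δα - Dα[V] - (2/ϱ)∂_ϱα) φ) dx dt = 0`, i.e. `∂ₜα + (V + 2x'/|x'|²)·∇α - Δα = 0` in
`𝒟'(S)`. Proof verbatim the tree's `integral_swirl_mul_timeDeriv_add_eq_zero` (momentum equation
tested with `φJ`, pressure removed by rotation averaging, `x`-derivatives transferred slice by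
slice onto the smooth-in-`x` velocity). [cite: Seregin2020, proof of Thm. 2.1, (2.2) (arXiv p. 4)] -/
theorem integral_swirl_mul_timeDeriv_add_eq_zero_offAxis
    (hS : ∀ θ : ℝ, ∀ z ∈ (S : Set (ℝ × (EuclideanSpace ℝ (Fin 3)))), stRot θ z ∈ (S : Set (ℝ × (EuclideanSpace ℝ (Fin 3)))))
    (hρ : ∀ z ∈ (S : Set (ℝ × (EuclideanSpace ℝ (Fin 3)))), cylRadius z.2 ≠ 0)
    (hV : IsSmoothAxisymmetricSolutionOn S V P) (hφ : IsSpaceTimeTestOn S φ) :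
    ∫ z : ℝ × (EuclideanSpace ℝ (Fin 3)), (swirl (V z.1) z.2 * timeDeriv φ z.1 z.2 +
      ((Δ (swirl (V z.1))) z.2 - fderiv ℝ (swirl (V z.1)) z.2 (V z.1 z.2) -
        2 / cylRadius z.2 * partialDeriv (eR z.2) (swirl (V z.1)) z.2) * φ z.1 z.2) = 0 := by
  have hQm : MeasurableSet (S : Set (ℝ × (EuclideanSpace ℝ (Fin 3)))) := S.isOpen.measurableSet
  have hNS := hV.suitable.distributional
  -- the test field `ψ = φ J`, its derivatives, and the weak form
  set ψ : ℝ → (EuclideanSpace ℝ (Fin 3)) → (EuclideanSpace ℝ (Fin 3)) := fun s y => φ s y • rotGen y with hψdef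
  have hψ : IsSpaceTimeTestOn S ψ := isSpaceTimeTestOn_smul_rotGen hφ
  have hφ' : ∀ j, IsSpaceTimeTestOn S (fun t x => fderiv ℝ (φ t) x ((EuclideanSpace.basisFun (Fin 3) ℝ) j)) :=
    fun j => isSpaceTimeTestOn_fderiv_apply hφ ((EuclideanSpace.basisFun (Fin 3) ℝ) j)
  have hφ'' : ∀ j, IsSpaceTimeTestOn S
      (fun t x => fderiv ℝ (fun y => fderiv ℝ (φ t) y ((EuclideanSpace.basisFun (Fin 3) ℝ) j)) x
        ((EuclideanSpace.basisFun (Fin 3) ℝ) j)) := fun j =>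
    isSpaceTimeTestOn_fderiv_apply (hφ' j) ((EuclideanSpace.basisFun (Fin 3) ℝ) j)
  -- space–time functions
  set α : ℝ × (EuclideanSpace ℝ (Fin 3)) → ℝ := fun z => swirl (V z.1) z.2 with hα
  set Pt : ℝ × (EuclideanSpace ℝ (Fin 3)) → ℝ := fun z => P z.1 z.2 * ⟪rotGen z.2, gradient (φ z.1) z.2⟫ with hPt
  set R : ℝ × (EuclideanSpace ℝ (Fin 3)) → ℝ := fun z => α z * timeDeriv φ z.1 z.2 +
    ∑ j, ((α z * ⟪V z.1 z.2, (EuclideanSpace.basisFun (Fin 3) ℝ) j⟫) *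
          fderiv ℝ (φ z.1) z.2 ((EuclideanSpace.basisFun (Fin 3) ℝ) j) -
      2 * (⟪rotGen (V z.1 z.2), (EuclideanSpace.basisFun (Fin 3) ℝ) j⟫ *
          fderiv ℝ (φ z.1) z.2 ((EuclideanSpace.basisFun (Fin 3) ℝ) j)) +
      α z * fderiv ℝ (fun y => fderiv ℝ (φ z.1) y ((EuclideanSpace.basisFun (Fin 3) ℝ) j)) z.2
        ((EuclideanSpace.basisFun (Fin 3) ℝ) j)) with hR
  set W : Fin 3 → ℝ × (EuclideanSpace ℝ (Fin 3)) → ℝ := fun j z =>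
    -fderiv ℝ (fun y => swirl (V z.1) y * ⟪V z.1 y, (EuclideanSpace.basisFun (Fin 3) ℝ) j⟫) z.2
        ((EuclideanSpace.basisFun (Fin 3) ℝ) j) +
      2 * ⟪rotGen (fderiv ℝ (V z.1) z.2 ((EuclideanSpace.basisFun (Fin 3) ℝ) j)),
        (EuclideanSpace.basisFun (Fin 3) ℝ) j⟫ +
      fderiv ℝ (fun y => fderiv ℝ (swirl (V z.1)) y ((EuclideanSpace.basisFun (Fin 3) ℝ) j)) z.2
        ((EuclideanSpace.basisFun (Fin 3) ℝ) j) with hW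
  -- (1) the weak form: `∫_S (R + Pt) = 0`
  have h1 : ∫ z in (S : Set (ℝ × (EuclideanSpace ℝ (Fin 3)))), (R z + Pt z) = 0 := by
    rw [← hNS.2.2.2.2 ψ hψ]
    refine setIntegral_congr_fun hQm fun z _ => ?_
    exact (nsIntegrand_smul_rotGen_eq_sum (V := V) (P := P) hφ z).symm
  -- (2) the pressure term vanishes
  have hP0 : ∫ z in (S : Set (ℝ × (EuclideanSpace ℝ (Fin 3)))), Pt z = 0 :=
    setIntegral_pressure_mul_inner_rotGen_gradient_eq_zero hS hNS hV.axisymmetric hφ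
  have hPi : IntegrableOn Pt (S : Set (ℝ × (EuclideanSpace ℝ (Fin 3)))) volume := by
    refine (integrableOn_pressure_mul_divergence hNS hψ).congr_fun (fun z _ => ?_) hQm
    have hφd : DifferentiableAt ℝ (φ z.1) z.2 :=
      ((hφ.contDiff_slice z.1).differentiable (by simp)).differentiableAt
    simp only [hPt, hψdef, divergence_smul_rotGen hφd]
  -- continuity on `S` of the velocity factors and integrability of the pieces of `R`
  have hαc : ContinuousOn α (S : Set (ℝ × (EuclideanSpace ℝ (Fin 3)))) := hV.continuousOn_swirl
  have hVc : ∀ j, ContinuousOn (fun z : ℝ × (EuclideanSpace ℝ (Fin 3)) => α z * ⟪V z.1 z.2, (EuclideanSpace.basisFun (Fin 3) ℝ) j⟫)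
      (S : Set (ℝ × (EuclideanSpace ℝ (Fin 3)))) :=
    fun j => hαc.mul (hV.continuousOn_inner_const ((EuclideanSpace.basisFun (Fin 3) ℝ) j))
  have hJc : ∀ j, ContinuousOn (fun z : ℝ × (EuclideanSpace ℝ (Fin 3)) => ⟪rotGen (V z.1 z.2), (EuclideanSpace.basisFun (Fin 3) ℝ) j⟫)
      (S : Set (ℝ × (EuclideanSpace ℝ (Fin 3)))) :=
    fun j => (rotGenL.continuous.comp_continuousOn hV.continuousOn_velocity).inner continuousOn_const
  have hWc : ∀ j, ContinuousOn (W j) (S : Set (ℝ × (EuclideanSpace ℝ (Fin 3)))) := fun j =>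
    ((continuousOn_fderiv_swirl_mul_inner hV ((EuclideanSpace.basisFun (Fin 3) ℝ) j)).neg.add
      (continuousOn_const.mul (continuousOn_inner_rotGen_fderiv hV ((EuclideanSpace.basisFun (Fin 3) ℝ) j)))).add
      (hV.continuousOn_fderiv_fderiv_swirl_apply ((EuclideanSpace.basisFun (Fin 3) ℝ) j))
  have iT : Integrable (fun z : ℝ × (EuclideanSpace ℝ (Fin 3)) => α z * timeDeriv φ z.1 z.2) :=
    integrable_mul_timeDeriv hαc hφ
  have iA : ∀ j, Integrable (fun z : ℝ × (EuclideanSpace ℝ (Fin 3)) =>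
      (α z * ⟪V z.1 z.2, (EuclideanSpace.basisFun (Fin 3) ℝ) j⟫) *
        fderiv ℝ (φ z.1) z.2 ((EuclideanSpace.basisFun (Fin 3) ℝ) j)) :=
    fun j => integrable_mul_test (hVc j) (hφ' j)
  have iB : ∀ j, Integrable (fun z : ℝ × (EuclideanSpace ℝ (Fin 3)) =>
      2 * (⟪rotGen (V z.1 z.2), (EuclideanSpace.basisFun (Fin 3) ℝ) j⟫ *
        fderiv ℝ (φ z.1) z.2 ((EuclideanSpace.basisFun (Fin 3) ℝ) j))) :=
    fun j => (integrable_mul_test (hJc j) (hφ' j)).const_mul 2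
  have iC : ∀ j, Integrable (fun z : ℝ × (EuclideanSpace ℝ (Fin 3)) =>
      α z * fderiv ℝ (fun y => fderiv ℝ (φ z.1) y ((EuclideanSpace.basisFun (Fin 3) ℝ) j)) z.2
        ((EuclideanSpace.basisFun (Fin 3) ℝ) j)) :=
    fun j => integrable_mul_test hαc (hφ'' j)
  have iAB : ∀ j, Integrable (fun z : ℝ × (EuclideanSpace ℝ (Fin 3)) =>
      (α z * ⟪V z.1 z.2, (EuclideanSpace.basisFun (Fin 3) ℝ) j⟫) *
          fderiv ℝ (φ z.1) z.2 ((EuclideanSpace.basisFun (Fin 3) ℝ) j) -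
      2 * (⟪rotGen (V z.1 z.2), (EuclideanSpace.basisFun (Fin 3) ℝ) j⟫ *
          fderiv ℝ (φ z.1) z.2 ((EuclideanSpace.basisFun (Fin 3) ℝ) j))) :=
    fun j => (iA j).sub (iB j)
  have iS : ∀ j, Integrable (fun z : ℝ × (EuclideanSpace ℝ (Fin 3)) =>
      (α z * ⟪V z.1 z.2, (EuclideanSpace.basisFun (Fin 3) ℝ) j⟫) *
          fderiv ℝ (φ z.1) z.2 ((EuclideanSpace.basisFun (Fin 3) ℝ) j) -
      2 * (⟪rotGen (V z.1 z.2), (EuclideanSpace.basisFun (Fin 3) ℝ) j⟫ *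
          fderiv ℝ (φ z.1) z.2 ((EuclideanSpace.basisFun (Fin 3) ℝ) j)) +
      α z * fderiv ℝ (fun y => fderiv ℝ (φ z.1) y ((EuclideanSpace.basisFun (Fin 3) ℝ) j)) z.2
        ((EuclideanSpace.basisFun (Fin 3) ℝ) j)) :=
    fun j => (iAB j).add (iC j)
  have iR : Integrable R := iT.add (integrable_finsetSum _ fun j _ => iS j)
  have iW : ∀ j, Integrable (fun z : ℝ × (EuclideanSpace ℝ (Fin 3)) => W j z * φ z.1 z.2) := fun j =>
    integrable_mul_test (hWc j) hφ
  -- (3) `∫ R = 0` over the whole space (`R` vanishes off `S`)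
  have hR0 : ∀ z, z ∉ (S : Set (ℝ × (EuclideanSpace ℝ (Fin 3)))) → R z = 0 := by
    intro z hz
    have hzφ : z ∉ tsupport (uncurry φ) := fun h => hz (hφ.tsupport_subset h)
    have hT : timeDeriv φ z.1 z.2 = 0 := timeDeriv_eq_zero_off_tsupport hzφ
    have hD : ∀ j, fderiv ℝ (φ z.1) z.2 ((EuclideanSpace.basisFun (Fin 3) ℝ) j) = 0 := fun j => by
      simp [fderiv_slice_eq_zero_of_notMem hzφ]
    have hDD : ∀ j, fderiv ℝ (fun y => fderiv ℝ (φ z.1) y ((EuclideanSpace.basisFun (Fin 3) ℝ) j)) z.2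
        ((EuclideanSpace.basisFun (Fin 3) ℝ) j) = 0 := fun j => by
      have hz' : z ∉ tsupport (uncurry fun t x => fderiv ℝ (φ t) x ((EuclideanSpace.basisFun (Fin 3) ℝ) j)) :=
        fun h => hz ((hφ' j).tsupport_subset h)
      have h0 : fderiv ℝ (fun y => fderiv ℝ (φ z.1) y ((EuclideanSpace.basisFun (Fin 3) ℝ) j)) z.2 = 0 :=
        fderiv_slice_eq_zero_of_notMem hz'
      rw [h0]
      simp
    simp only [hR, hT, hD, hDD, mul_zero, sub_zero, add_zero, Finset.sum_const_zero]
  have h3 : ∫ z, R z = 0 := by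
    have hsplit : ∫ z in (S : Set (ℝ × (EuclideanSpace ℝ (Fin 3)))), (R z + Pt z) =
        (∫ z in (S : Set (ℝ × (EuclideanSpace ℝ (Fin 3)))), R z) + ∫ z in (S : Set (ℝ × (EuclideanSpace ℝ (Fin 3)))), Pt z :=
      integral_add iR.integrableOn hPi
    rw [hsplit, hP0, add_zero] at h1
    rw [← setIntegral_eq_integral_of_forall_compl_eq_zero (s := (S : Set (ℝ × (EuclideanSpace ℝ (Fin 3)))))
      fun z hz => hR0 z hz]
    exact h1
  -- (4) linearity and integration by parts, summand by summand
  have h4 : ∫ z, R z = (∫ z : ℝ × (EuclideanSpace ℝ (Fin 3)), α z * timeDeriv φ z.1 z.2) +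
      ∑ j, ((∫ z : ℝ × (EuclideanSpace ℝ (Fin 3)), (α z * ⟪V z.1 z.2, (EuclideanSpace.basisFun (Fin 3) ℝ) j⟫) *
              fderiv ℝ (φ z.1) z.2 ((EuclideanSpace.basisFun (Fin 3) ℝ) j)) -
        2 * (∫ z : ℝ × (EuclideanSpace ℝ (Fin 3)), ⟪rotGen (V z.1 z.2), (EuclideanSpace.basisFun (Fin 3) ℝ) j⟫ *
              fderiv ℝ (φ z.1) z.2 ((EuclideanSpace.basisFun (Fin 3) ℝ) j)) +
        ∫ z : ℝ × (EuclideanSpace ℝ (Fin 3)), α z * fderiv ℝ (fun y => fderiv ℝ (φ z.1) y ((EuclideanSpace.basisFun (Fin 3) ℝ) j)) z.2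
              ((EuclideanSpace.basisFun (Fin 3) ℝ) j)) := by
    simp only [hR]
    rw [integral_add iT (integrable_finsetSum _ fun j _ => iS j),
      integral_finsetSum _ fun j _ => iS j]
    congr 1
    refine Finset.sum_congr rfl fun j _ => ?_
    rw [integral_add (iAB j) (iC j), integral_sub (iA j) (iB j), integral_const_mul]
  have hIBP : ∀ j, ((∫ z : ℝ × (EuclideanSpace ℝ (Fin 3)), (α z * ⟪V z.1 z.2, (EuclideanSpace.basisFun (Fin 3) ℝ) j⟫) *
              fderiv ℝ (φ z.1) z.2 ((EuclideanSpace.basisFun (Fin 3) ℝ) j)) -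
        2 * (∫ z : ℝ × (EuclideanSpace ℝ (Fin 3)), ⟪rotGen (V z.1 z.2), (EuclideanSpace.basisFun (Fin 3) ℝ) j⟫ *
              fderiv ℝ (φ z.1) z.2 ((EuclideanSpace.basisFun (Fin 3) ℝ) j)) +
        ∫ z : ℝ × (EuclideanSpace ℝ (Fin 3)), α z * fderiv ℝ (fun y => fderiv ℝ (φ z.1) y ((EuclideanSpace.basisFun (Fin 3) ℝ) j)) z.2
              ((EuclideanSpace.basisFun (Fin 3) ℝ) j)) =
      ∫ z : ℝ × (EuclideanSpace ℝ (Fin 3)), W j z * φ z.1 z.2 := by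
    intro j
    have i1 := integrable_mul_test (continuousOn_fderiv_swirl_mul_inner hV ((EuclideanSpace.basisFun (Fin 3) ℝ) j)) hφ
    have i2 := integrable_mul_test (continuousOn_inner_rotGen_fderiv hV ((EuclideanSpace.basisFun (Fin 3) ℝ) j)) hφ
    have i3 := integrable_mul_test (hV.continuousOn_fderiv_fderiv_swirl_apply ((EuclideanSpace.basisFun (Fin 3) ℝ) j)) hφ
    have e : (fun z : ℝ × (EuclideanSpace ℝ (Fin 3)) => W j z * φ z.1 z.2) = fun z =>
        (-(fderiv ℝ (fun y => swirl (V z.1) y * ⟪V z.1 y, (EuclideanSpace.basisFun (Fin 3) ℝ) j⟫) z.2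
            ((EuclideanSpace.basisFun (Fin 3) ℝ) j) * φ z.1 z.2) +
          2 * (⟪rotGen (fderiv ℝ (V z.1) z.2 ((EuclideanSpace.basisFun (Fin 3) ℝ) j)),
            (EuclideanSpace.basisFun (Fin 3) ℝ) j⟫ * φ z.1 z.2)) +
          fderiv ℝ (fun y => fderiv ℝ (swirl (V z.1)) y ((EuclideanSpace.basisFun (Fin 3) ℝ) j)) z.2
            ((EuclideanSpace.basisFun (Fin 3) ℝ) j) * φ z.1 z.2 := by
      funext z
      simp only [hW]
      ring
    have i1n : Integrable (fun z : ℝ × (EuclideanSpace ℝ (Fin 3)) =>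
        -(fderiv ℝ (fun y => swirl (V z.1) y * ⟪V z.1 y, (EuclideanSpace.basisFun (Fin 3) ℝ) j⟫) z.2
          ((EuclideanSpace.basisFun (Fin 3) ℝ) j) * φ z.1 z.2)) := i1.neg
    have i2c : Integrable (fun z : ℝ × (EuclideanSpace ℝ (Fin 3)) =>
        2 * (⟪rotGen (fderiv ℝ (V z.1) z.2 ((EuclideanSpace.basisFun (Fin 3) ℝ) j)),
          (EuclideanSpace.basisFun (Fin 3) ℝ) j⟫ * φ z.1 z.2)) := i2.const_mul 2
    have i12 : Integrable (fun z : ℝ × (EuclideanSpace ℝ (Fin 3)) =>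
        (-(fderiv ℝ (fun y => swirl (V z.1) y * ⟪V z.1 y, (EuclideanSpace.basisFun (Fin 3) ℝ) j⟫) z.2
            ((EuclideanSpace.basisFun (Fin 3) ℝ) j) * φ z.1 z.2) +
          2 * (⟪rotGen (fderiv ℝ (V z.1) z.2 ((EuclideanSpace.basisFun (Fin 3) ℝ) j)),
            (EuclideanSpace.basisFun (Fin 3) ℝ) j⟫ * φ z.1 z.2))) := i1n.add i2c
    rw [e, integral_add i12 i3, integral_add i1n i2c, integral_neg, integral_const_mul]
    simp only [hα]
    rw [integral_swirl_mul_inner_mul_fderiv hV hφ ((EuclideanSpace.basisFun (Fin 3) ℝ) j),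
      integral_inner_rotGen_mul_fderiv hV hφ ((EuclideanSpace.basisFun (Fin 3) ℝ) j),
      integral_swirl_mul_fderiv_fderiv hV hφ ((EuclideanSpace.basisFun (Fin 3) ℝ) j)]
    ring
  -- (5) the pointwise identity on `S` and the conclusion
  have h5 : ∫ z, R z = ∫ z : ℝ × (EuclideanSpace ℝ (Fin 3)), (α z * timeDeriv φ z.1 z.2 + (∑ j, W j z) * φ z.1 z.2) := by
    rw [h4]
    simp only [hIBP]
    rw [← integral_finsetSum _ fun j _ => iW j,
      ← integral_add iT (integrable_finsetSum _ fun j _ => iW j)]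
    refine integral_congr_ae (Eventually.of_forall fun z => ?_)
    simp only [Finset.sum_mul]
  have h6 : ∫ z : ℝ × (EuclideanSpace ℝ (Fin 3)), (α z * timeDeriv φ z.1 z.2 + (∑ j, W j z) * φ z.1 z.2) =
      ∫ z : ℝ × (EuclideanSpace ℝ (Fin 3)), (swirl (V z.1) z.2 * timeDeriv φ z.1 z.2 +
        ((Δ (swirl (V z.1))) z.2 - fderiv ℝ (swirl (V z.1)) z.2 (V z.1 z.2) -
          2 / cylRadius z.2 * partialDeriv (eR z.2) (swirl (V z.1)) z.2) * φ z.1 z.2) := by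
    refine integral_congr_ae (Eventually.of_forall fun z => ?_)
    by_cases hz : z ∈ (S : Set (ℝ × (EuclideanSpace ℝ (Fin 3))))
    · have key : ∑ j, W j z = (Δ (swirl (V z.1))) z.2 - fderiv ℝ (swirl (V z.1)) z.2 (V z.1 z.2) -
          2 / cylRadius z.2 * partialDeriv (eR z.2) (swirl (V z.1)) z.2 := by
        simp only [hW]
        exact sum_transfer_eq_swirlOperator_offAxis hV hz (hρ z hz)
      simp only [hα, key]
    · simp only [hφ.apply_eq_zero hz, mul_zero, add_zero, hα]
  rw [← h6, ← h5, h3]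

/-! ### The time-integrated swirl equation at every point -/

/-- **Seregin 2020, (2.2), integrated in time at every point of a rotation-invariant off-axis
product region.** Let `S = ]lo, hi[ × U` (`U ⊆ (EuclideanSpace ℝ (Fin 3))` open) be invariant under the rotations about
the axis and disjoint from the axis, and `(V, P)` in the class `IsSmoothAxisymmetricSolutionOn S`.
Then for every `x ∈ U` and all `lo < s ≤ t < hi`,
`α(t, x) - α(s, x) = ∫ₛᵗ (Δα - Dα[V] - (2/ϱ)∂_ϱα)(r, x) dr`, `α = x₀V₁ - x₁V₀ = ϱ V_φ` — the swirl
equation (2.2) `∂ₜσ + (v + 2x'/|x'|²)·∇σ - Δσ = 0` off the axis with a classical `∂ₜ`, in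
time-integrated form (the tree's `SwirlEquation_holds` for a general region; from the weak form
`integral_swirl_mul_timeDeriv_add_eq_zero_offAxis`, the continuity of both sides on `S` and the
accepted localisation `sub_eq_intervalIntegral_of_forall_test`).
[cite: Seregin2020, proof of Thm. 2.1, (2.2) (arXiv p. 4)] -/
theorem swirl_sub_eq_intervalIntegral_offAxis {lo hi : ℝ} {U : Set (EuclideanSpace ℝ (Fin 3))} (hU : IsOpen U)
    (hSU : (S : Set (ℝ × (EuclideanSpace ℝ (Fin 3)))) = Ioo lo hi ×ˢ U)
    (hS : ∀ θ : ℝ, ∀ z ∈ (S : Set (ℝ × (EuclideanSpace ℝ (Fin 3)))), stRot θ z ∈ (S : Set (ℝ × (EuclideanSpace ℝ (Fin 3)))))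
    (hρ : ∀ z ∈ (S : Set (ℝ × (EuclideanSpace ℝ (Fin 3)))), cylRadius z.2 ≠ 0)
    (hV : IsSmoothAxisymmetricSolutionOn S V P) {x : (EuclideanSpace ℝ (Fin 3))} (hx : x ∈ U) {s t : ℝ} (hs : lo < s)
    (hst : s ≤ t) (ht : t < hi) :
    swirl (V t) x - swirl (V s) x =
      ∫ r in s..t, ((Δ (swirl (V r))) x - fderiv ℝ (swirl (V r)) x (V r x) -
        2 / cylRadius x * partialDeriv (eR x) (swirl (V r)) x) :=
  sub_eq_intervalIntegral_of_forall_test (Q := S)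
    (a := fun z : ℝ × (EuclideanSpace ℝ (Fin 3)) => swirl (V z.1) z.2)
    (G := fun z : ℝ × (EuclideanSpace ℝ (Fin 3)) => (Δ (swirl (V z.1))) z.2 - fderiv ℝ (swirl (V z.1)) z.2 (V z.1 z.2) -
      2 / cylRadius z.2 * partialDeriv (eR z.2) (swirl (V z.1)) z.2)
    hU hSU hV.continuousOn_swirl (continuousOn_swirlOperator_offAxis hV hρ)
    (fun _ hφ => integral_swirl_mul_timeDeriv_add_eq_zero_offAxis hS hρ hV hφ) hx hs hst ht

/-- **The swirl is `C¹` in time off the axis, with the classical derivative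
`∂ₜα = Δα - Dα[V] - (2/ϱ)∂_ϱα`** (same setting): for `x ∈ U` and `t ∈ ]lo, hi[`,
`HasDerivAt (r ↦ α(r, x)) ((Δα - Dα[V] - (2/ϱ)∂_ϱα)(t, x)) t` (the time-integrated identity and
the continuity of the integrand in `r`). [cite: Seregin2020, proof of Thm. 2.1, (2.2) (arXiv p. 4)] -/
theorem hasDerivAt_swirl_offAxis {lo hi : ℝ} {U : Set (EuclideanSpace ℝ (Fin 3))} (hU : IsOpen U)
    (hSU : (S : Set (ℝ × (EuclideanSpace ℝ (Fin 3)))) = Ioo lo hi ×ˢ U)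
    (hS : ∀ θ : ℝ, ∀ z ∈ (S : Set (ℝ × (EuclideanSpace ℝ (Fin 3)))), stRot θ z ∈ (S : Set (ℝ × (EuclideanSpace ℝ (Fin 3)))))
    (hρ : ∀ z ∈ (S : Set (ℝ × (EuclideanSpace ℝ (Fin 3)))), cylRadius z.2 ≠ 0)
    (hV : IsSmoothAxisymmetricSolutionOn S V P) {x : (EuclideanSpace ℝ (Fin 3))} (hx : x ∈ U) {t : ℝ} (ht : t ∈ Ioo lo hi) :
    HasDerivAt (fun r => swirl (V r) x)
      ((Δ (swirl (V t))) x - fderiv ℝ (swirl (V t)) x (V t x) -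
        2 / cylRadius x * partialDeriv (eR x) (swirl (V t)) x) t := by
  -- a base time `s₀ ∈ ]lo, t[`
  set s₀ : ℝ := (lo + t) / 2 with hs₀
  have hs₀lo : lo < s₀ := by rw [hs₀]; linarith [ht.1]
  have hs₀t : s₀ < t := by rw [hs₀]; linarith [ht.1]
  set G : ℝ → ℝ := fun r => (Δ (swirl (V r))) x - fderiv ℝ (swirl (V r)) x (V r x) -
    2 / cylRadius x * partialDeriv (eR x) (swirl (V r)) x with hG
  -- continuity of `G` on `]lo, hi[`
  have hGc : ContinuousOn G (Ioo lo hi) := by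
    have hmk : Continuous fun r : ℝ => ((r, x) : ℝ × (EuclideanSpace ℝ (Fin 3))) := continuous_id.prodMk continuous_const
    refine ContinuousOn.comp (g := fun z : ℝ × (EuclideanSpace ℝ (Fin 3)) => (Δ (swirl (V z.1))) z.2 -
      fderiv ℝ (swirl (V z.1)) z.2 (V z.1 z.2) - 2 / cylRadius z.2 * partialDeriv (eR z.2) (swirl (V z.1)) z.2)
      (f := fun r : ℝ => ((r, x) : ℝ × (EuclideanSpace ℝ (Fin 3)))) (continuousOn_swirlOperator_offAxis hV hρ) hmk.continuousOn ?_
    intro r hr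
    show ((r, x) : ℝ × (EuclideanSpace ℝ (Fin 3))) ∈ (S : Set (ℝ × (EuclideanSpace ℝ (Fin 3))))
    rw [hSU]
    exact ⟨hr, hx⟩
  -- the identity `α(r, x) = α(s₀, x) + ∫_{s₀}^r G` near `t`
  have hnhds : Ioo s₀ hi ∈ 𝓝 t := Ioo_mem_nhds hs₀t ht.2
  have heq : (fun r => swirl (V r) x) =ᶠ[𝓝 t] fun r => swirl (V s₀) x + ∫ u in s₀..r, G u := by
    filter_upwards [hnhds] with r hr
    have h := swirl_sub_eq_intervalIntegral_offAxis hU hSU hS hρ hV hx hs₀lo hr.1.le hr.2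
    simp only [hG]
    linarith [h]
  -- differentiate the primitive
  have hGi : IntervalIntegrable G volume s₀ t := by
    rw [intervalIntegrable_iff_integrableOn_Icc_of_le hs₀t.le]
    exact (hGc.mono (Icc_subset_Ioo hs₀lo ht.2)).integrableOn_Icc
  have hGm : StronglyMeasurableAtFilter G (𝓝 t) volume :=
    hGc.stronglyMeasurableAtFilter isOpen_Ioo _ ht
  have hGt : ContinuousAt G t := hGc.continuousAt (Ioo_mem_nhds ht.1 ht.2)
  have hprim : HasDerivAt (fun r => ∫ u in s₀..r, G u) (G t) t :=
    intervalIntegral.integral_hasDerivAt_right hGi hGm hGt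
  have hsum : HasDerivAt (fun r => swirl (V s₀) x + ∫ u in s₀..r, G u) (G t) t := by
    simpa using hprim.const_add (swirl (V s₀) x)
  exact hsum.congr_of_eventuallyEq heq

end Seregin2020

end Literature.Analysis.FluidPDE
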